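import Summits.BirchSwinnertonDyer.BirchSwinnertonDyer.Theorems.GenusKolyvaginAtTwoMinimalTwinBSDTwoIdentityDoor
import Summits.BirchSwinnertonDyer.BirchSwinnertonDyer.Theorems.GenusKolyvaginAtTwoGenusPrimitiveSupplyAtTwoDoorFieldSelmerBracket
import Summits.BirchSwinnertonDyer.BirchSwinnertonDyer.Theorems.GenusKolyvaginAtTwoGenusPrimitiveSupplyAtTwoPosDiscShallowKFourPosConjTrivialSelmerModMW
import Summits.BirchSwinnertonDyer.BirchSwinnertonDyer.Theorems.GenusKolyvaginAtTwoPowDvdShaCardAtTwoRTRelaxedSelmerGenusBudget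
import Summits.BirchSwinnertonDyer.BirchSwinnertonDyer.Theorems.GenusKolyvaginAtTwoMinimalTwinBSDTwoEggAllImages
import Summits.BirchSwinnertonDyer.BirchSwinnertonDyer.Theorems.GenusKolyvaginAtTwoMinimalTwinBSDTwoEggSplit
import Literature.NumberTheory.EllipticCurves.SelmerTrivialCorankProofs
import HarnessLib

/-!
# Route `GenusKolyvaginAtTwo`, crux U₂ `MinimalTwinBSDTwo` (stmt-BirchSwinnertonDyer-22985), LINE 23 «twin_swap», stub KEX_id:
# THE K-SIDE OF THE IDENTITY-PRIME DOOR — `#Sel₂(W_K/K) = 8` and `#Ш(W_K/K)[2] = #Ш(W_K/K)[2^∞] = 4`, UNCONDITIONALLY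

Seat `bsd-line-gk2-p3` g33 (PROVER seat 3/3, cell `bsd-f1-sign2`), `--supports stmt-BirchSwinnertonDyer-22985` (helper; closes nothing).
THEOREMS ONLY (no definition, no named fact, no `sorry`); standard axioms.  **BSD is NOT proved by this file; U₂ is NOT proved; nothing
is closed.**

THE POINT.  LINE 23 v2.0/v2.1 (gk2-p2 g26) covers the `Δ > 0` IDENTITY LOCUS of U₂ (`r_an = 1`, `#Sel₂(W) = 2`, `W(ℚ) ⊂ W⁰(ℝ)`) through an
IDENTITY-PRIME DOOR `K = ℚ(√−ℓ)` (`W[2] ⊂ W(ℚ_ℓ)`, `2` split, Heegner, `loc_ℓ` injective on `Sel₂^{rel ∞}(W)`), where the reversed twin is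
`2`-Selmer-TRIVIAL (`natCard_selmerGroup_twin_eq_one_of_identityDoor`).  The stub KEX_id there is «`#Ш(W_K)[2^∞] · 4^{ord₂ c + ord₂ C(W)} = 4^{M₀}`»
with the remark «BSD predicts `#Ш(W_K)[2^∞] = 4`».  THIS FILE PROVES THAT PREDICTION UNCONDITIONALLY (finiteness of `Ш(W_K)[2^∞]` displayed):
* §1 `mem_selmerGroup_kummerRelaxed_pair_of_resTorsion_mem_selmerGroup` — exact descent off `{∞, ℓ}`: `res_K⁻¹ Sel₂(W_K) ⊆ H¹_{𝓚^{∞,ℓ}}(ℚ, W[2])`;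
* §2 `natCard_selmerGroup_kummerRelaxed_pair_eq_eight_of_identityDoor` — `#H¹_{𝓚^{∞,ℓ}} = 8` (gk2-p2's two-place count `2 · 4`, strict part `0`);
* §3 ★ `natCard_selmerGroup_baseChange_eq_eight_and_sha_two_eq_four_of_identityDoor` — `#Sel₂(W_K/K) = 8`, `#Ш(W_K/K)[2] = 4`: the kernel of
  `m ↦ m + σ₀m` on `M = Sel₂(W_K)` is `res_K(res_K⁻¹ M)` (inflation–restriction), of order `≤ 8`; the image lies in `κ₂(W(K))` (gk2-p5's
  `conjAct_sub_self_mem_range_kummerMapTorsion`, the twin having `Ш[2^∞] = 0`), of order `2`; `#M = 2 · #Ш(W_K)[2]` with `#Ш(W_K)[2]` a square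
  (Cassels–Tate over `K`) and `#M ≥ 4` (AN-10K) force `#M = 8`;
* §4 ★ `natCard_primaryComponent_sha_baseChange_two_eq_four_of_identityDoor` — `#Ш(W_K/K)[2^∞] = 4` by gk2-p4's one-bit law.
READING (census, not progress): on the identity locus KEX_id ⟺ «`2^{ord₂ c + ord₂ C(W) + 1} ∥ P(1)`» (EXP-shaped, one bit deeper than EXP±_all).
Beyond print: no (Kramer 1981 Thm. 1 / Mazur–Rubin 2010 descent algebra at an identity prime).  BSD is NOT proved; nothing is closed.

References: [Kramer1981] Thm. 1, Prop. 3, Prop. 7, Thm. 2; [MazurRubin2010] Lemmas 2.9–2.11, Lemma 3.2, Prop. 3.3; [SilvermanAEC2009] X.4.2,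
Ex. 10.16; [MilneADT2006] I Thm. 2.8, 2.13, 4.10, Prop. 3.8, Rem. 6.10; [Cassels1962ArithmeticIV] §1; [GrossLMS1991] §5 (5.1)–(5.3).
-/

set_option linter.dupNamespace false -- tree convention: `Summit.BirchSwinnertonDyer.BirchSwinnertonDyer.Theorems` (summit = sub-problem)
set_option autoImplicit false

noncomputable section

open scoped Classical ContRepresentation

open CategoryTheory Field Function NumberField IsDedekindDomain WeierstrassCurve
open Literature.NumberTheory.EllipticCurves
open Literature.NumberTheory.GaloisRepresentations
open Literature.NumberTheory.GaloisRepresentations.DiscreteGaloisModule (SelmerStructure)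
open Literature.NumberTheory.GaloisCohomology
open Summit.BirchSwinnertonDyer.Rank1Residual
open Summit.BirchSwinnertonDyer.Rank1Residual.X11b.KummerPT (kummerRelaxed kummerStrict kummerRelaxed_of_mem kummerRelaxed_of_not_mem
  kummerStrict_of_mem kummerStrict_of_not_mem)
open Summit.BirchSwinnertonDyer.BirchSwinnertonDyer.Theorems.GenusKolyArch
open Summit.BirchSwinnertonDyer.BirchSwinnertonDyer.Theorems.GenusExact.TwinSwap.IdentityDoor
open Summit.BirchSwinnertonDyer.BirchSwinnertonDyer.Theorems.GenusKolyTwistLocal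
open Summit.BirchSwinnertonDyer.BirchSwinnertonDyer.Theorems.SchneiderFreeAdditiveX3.PoitouTateReduction
  (poitouTate_selmerStructure_duality_real_holds)
open Summit.BirchSwinnertonDyer.Rank1Residual.F1Sign2 (selmerGroupRelaxedAtInfinityAtTwo MeetsEgg NoRationalTwoTorsion ShaTwoTrivial)
open Summit.BirchSwinnertonDyer.BirchSwinnertonDyer.Theorems.GenusKolyTransp (selmerGroupRelaxedAtInfinityAtTwo_eq_kummerRelaxed)
open Rat.HeightOneSpectrum (primesEquiv)
open Literature.Barriers.BirchSwinnertonDyer (Matsuno2009.primePlace)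

namespace Summit.BirchSwinnertonDyer.BirchSwinnertonDyer.Theorems.GenusExact.TwinSwap.IdentityDoorSha

variable (W : WeierstrassCurve ℚ) [W.IsElliptic] [W.IsGloballyMinimal] (K : Type) [Field K] [NumberField K]

/-! ## §1 Exact descent off `{∞, ℓ}` -/

omit [W.IsGloballyMinimal] in
/-- **EXACT DESCENT OFF `{∞, ℓ}`.**  `W/ℚ` globally minimal elliptic; `K` imaginary quadratic with `d_K = −ℓ` odd (`ℓ` prime), Heegner for
`N_W`; `v₀` the place of `ℚ` over `ℓ`.  If `x ∈ H¹(ℚ, W[2])` restricts into `Sel₂(W_K/K)`, then `x ∈ H¹_{𝓚^{∞,ℓ}}(ℚ, W[2])`: it satisfies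
`W`'s Kummer condition at every finite place `p ≠ ℓ` — `p ∤ d_K`, and `p` is either of good reduction (then unramified in `K`) or of bad
reduction (then split in `K` by the Heegner hypothesis), so the `K_w`- and `ℚ_p`-conditions coincide (the lineage's dictionary
`PlusDescent.selmerLocalKer_adicCompletion_eq_of_not_dvd_discr_of_imp`); at `ℓ` and `∞` nothing is claimed.  Kramer 1981, proof of Thm. 1,
at the places with vanishing local norm index. [cite: Kramer1981, Thm. 1 (proof), Prop. 3] [cite: MilneADT2006, Ch. I Prop. 3.8]
[cite: DokchitserDokchitserAnnals2010, Lemma 4.14 (proof)] -/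
theorem mem_selmerGroup_kummerRelaxed_pair_of_resTorsion_mem_selmerGroup (h2 : Module.finrank ℚ K = 2)
    (hodd : Odd (discr K)) (hH : SatisfiesHeegnerHypothesis (W.conductorNorm ℤ) K)
    {ℓ : ℕ} (hℓ : ℓ.Prime) (hd : discr K = -(ℓ : ℤ)) {v₀ : HeightOneSpectrum (𝓞 ℚ)} (hℓv₀ : (ℓ : 𝓞 ℚ) ∈ v₀.asIdeal)
    {x : galH1Torsion W ((2 : ℕ) : ℤ)} (hx : resTorsion W K ((2 : ℕ) : ℤ) x ∈ (W.baseChange K).selmerGroup ((2 : ℕ) : ℤ)) :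
    x ∈ (kummerRelaxed W 2 {(Sum.inl Rat.infinitePlace : Place ℚ), Sum.inr v₀}).selmerGroup := by
  refine ((kummerRelaxed W 2 _).mem_selmerGroup_iff x).mpr fun v ↦ ?_
  by_cases hv : v ∈ ({(Sum.inl Rat.infinitePlace : Place ℚ), Sum.inr v₀} : Finset (Place ℚ))
  · rw [kummerRelaxed_of_mem W 2 _ hv]
    exact AddSubgroup.mem_top _
  rw [kummerRelaxed_of_not_mem W 2 _ hv]
  rcases v with w | u
  · exact absurd (by rw [Subsingleton.elim w Rat.infinitePlace]; exact Finset.mem_insert_self _ _) hv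
  · have huv₀ : u ≠ v₀ := fun h ↦ hv (by rw [h]; exact Finset.mem_insert_of_mem (Finset.mem_singleton_self _))
    rw [← AddSubgroup.mem_comap, W.comap_localization_kummerSelmerStructure ((2 : ℕ) : ℤ) (Sum.inr u),
      W.selmerLocalKer_completion_inr ((2 : ℕ) : ℤ) u]
    obtain ⟨p, hp, rfl⟩ := exists_eq_primePlace u
    -- `p ≠ ℓ`: the place over `ℓ` is `v₀ ∈ S`
    have hpℓ : p ≠ ℓ := by
      rintro rfl
      apply huv₀
      rw [(natCast_mem_asIdeal_iff_eq_primesEquiv_symm v₀ hp).mp hℓv₀]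
      unfold Matsuno2009.primePlace
      rw [dif_pos hp]
    have hpd : ¬ (p : ℤ) ∣ discr K := by
      rw [hd, dvd_neg]
      intro h
      exact hpℓ ((Nat.prime_dvd_prime_iff_eq hp hℓ).mp (by exact_mod_cast h))
    -- bad primes split (Heegner hypothesis), so a non-split `p ≠ ℓ` is good
    have hgood : ((Ideal.span {(p : ℤ)}).primesOver (𝓞 K)).ncard ≠ 2 → W.HasGoodReductionAt (Matsuno2009.primePlace p) := by
      intro hns
      by_contra hbad
      apply hns
      have hdvd : ((primesEquiv (Matsuno2009.primePlace p) : Nat.Primes) : ℕ) ∣ W.conductorNorm ℤ :=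
        (W.dvd_conductorNorm_iff _).mpr hbad
      rw [Literature.Barriers.BirchSwinnertonDyer.Matsuno2009.primesEquiv_primePlace hp] at hdvd
      exact hH p hp hdvd
    obtain ⟨w, hw⟩ := Literature.Barriers.BirchSwinnertonDyer.exists_heightOneSpectrum_liesOver K p
    haveI := hw
    rw [← PlusDescent.selmerLocalKer_adicCompletion_eq_of_not_dvd_discr_of_imp W ((2 : ℕ) : ℤ) h2 hodd hp hpd hgood w]
    exact PlusDescent.mem_selmerLocalKer_adicCompletion_of_resTorsion_mem W K ((2 : ℕ) : ℤ) hx (Matsuno2009.primePlace p) w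

/-! ## §2 The count `#H¹_{𝓚^{∞,ℓ}}(ℚ, W[2]) = 8` at an identity-prime door -/

/-- **`#H¹_{𝓚^{∞,ℓ}}(ℚ, W[2]) = 8` at an identity-prime door.**  `W/ℚ` globally minimal elliptic with `Δ_W > 0`; `K` imaginary quadratic,
`d_K = −ℓ` odd (`ℓ` prime), Heegner for `N_W`; `ℓ` an IDENTITY prime (`#W(ℚ_ℓ)[2] = 4`); the localisation at `ℓ` injective on the ∞-relaxed
Selmer group `Sel₂^{rel ∞}(W)`.  Then the Kummer structure relaxed at `{∞, ℓ}` has Selmer group of order `8`: gk2-p2's mixed two-place count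
`[H¹_{𝓚^{∞,ℓ}} : H¹_{𝓚_{∞,ℓ}}] = #𝓛_∞ · (#W(ℚ_ℓ)[2] · #(ℤ_ℓ/2)) = 2 · 4` (`relIndex_kummerStrict_kummerRelaxed_inl_inr_eq_of_facts`, Poitou–Tate with
real places and Tate's χ being tree theorems over `ℚ`) and `H¹_{𝓚_{∞,ℓ}} = 0` (a class strict at `∞` and `ℓ` and Kummer elsewhere lies in
`Sel₂^{rel ∞}(W) ∩ ker loc_ℓ = 0`).  [cite: MazurRubin2010, Lemma 3.2] [cite: MilneADT2006, Ch. I, Thm. 2.13 and Thm. 4.10] -/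
theorem natCard_selmerGroup_kummerRelaxed_pair_eq_eight_of_identityDoor (hΔ : 0 < W.Δ)
    (hK : IsImaginaryQuadratic K) (hodd : Odd (discr K)) (hH : SatisfiesHeegnerHypothesis (W.conductorNorm ℤ) K)
    {ℓ : ℕ} [Fact ℓ.Prime] (hd : discr K = -(ℓ : ℤ))
    (hid : Nat.card {Q : (W.baseChange ℚ_[ℓ]).toAffine.Point // 2 • Q = 0} = 4)
    (hinj : ∀ c ∈ selmerGroupRelaxedAtInfinityAtTwo W, c ∈ MazurRubin2010.strictLocalKer W ℚ_[ℓ] 2 → c = 0)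
    {v₀ : HeightOneSpectrum (𝓞 ℚ)} (hv₀ : ((primesEquiv v₀ : Nat.Primes) : ℕ) = ℓ) :
    Nat.card (kummerRelaxed W 2 {(Sum.inl Rat.infinitePlace : Place ℚ), Sum.inr v₀}).selmerGroup = 8 := by
  haveI : Fact (Nat.Prime 2) := ⟨Nat.prime_two⟩
  have hℓ : ℓ.Prime := Fact.out
  obtain ⟨hℓ2, -, -⟩ := GenusKolyTwin.prime_discr_facts W hK hodd hH hℓ hd
  have hPT := poitouTate_selmerStructure_duality_real_holds (K := ℚ)
  have hEP := GenusKolyLowering.localEP ℚ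
  have hℓv₀ : (ℓ : 𝓞 ℚ) ∈ v₀.asIdeal := by
    rw [← hv₀]
    exact Rat.HeightOneSpectrum.natCast_natGenerator_mem v₀
  have h2v₀ : ((2 : ℕ) : 𝓞 ℚ) ∉ v₀.asIdeal :=
    GenusKolyTwistingPrime.natCast_not_mem_of_not_dvd hℓ hℓv₀ fun h ↦
      hℓ2 ((Nat.prime_dvd_prime_iff_eq hℓ Nat.prime_two).mp h)
  have h12 : (Sum.inl Rat.infinitePlace : Place ℚ) ≠ Sum.inr v₀ := Sum.inl_ne_inr
  set S : Finset (Place ℚ) := {(Sum.inl Rat.infinitePlace : Place ℚ), Sum.inr v₀} with hSdef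
  have hv₀S : (Sum.inr v₀ : Place ℚ) ∈ S := by simp [hSdef]
  have hwS : (Sum.inl Rat.infinitePlace : Place ℚ) ∈ S := by simp [hSdef]
  -- `t_ℓ = #W(ℚ_ℓ)[2] · #(ℤ_ℓ/2) = 4`
  have ht : Nat.card (nsmulAddMonoidHom 2 : (W.baseChange (v₀.adicCompletion ℚ)).toAffine.Point →+ _).ker *
      Nat.card (v₀.adicCompletionIntegers ℚ ⧸ Ideal.span {((2 : ℕ) : v₀.adicCompletionIntegers ℚ)}) = 4 := by
    rw [natCard_ker_nsmul_adicCompletion_eq_padic W v₀ 2, natCard_quotient_span_natCast_eq_one_of_not_mem v₀ h2v₀, mul_one]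
    subst hv₀
    exact hid
  -- `#𝓛_∞ = 2`
  have hℓw : Nat.card (W.kummerSelmerStructure ((2 : ℕ) : ℤ) (Sum.inl Rat.infinitePlace)) = 2 :=
    natCard_kummerSelmerStructure_inl_rat_eq_two_of_Δ_pos W hΔ _
  -- the injectivity in the structure language
  have hinj' : ∀ c ∈ (kummerRelaxed W 2 {(Sum.inl Rat.infinitePlace : Place ℚ)}).selmerGroup,
      galoisCohomology.localization (W.torsionGaloisModule ((2 : ℕ) : ℤ)) (Sum.inr v₀) 1 c = 0 → c = 0 := by
    intro c hc h0
    rw [← selmerGroupRelaxedAtInfinityAtTwo_eq_kummerRelaxed] at hc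
    refine hinj c hc ?_
    have h1 : c ∈ W.torsionLocalKer (v₀.adicCompletion ℚ) ((2 : ℕ) : ℤ) :=
      (mem_torsionLocalKer_iff_localization_eq_zero_rat W v₀ c).mpr h0
    haveI := Fact.mk (primesEquiv v₀).2
    letI : Algebra ℚ (v₀.adicCompletion ℚ) := inferInstance
    haveI : CharZero (v₀.adicCompletion ℚ) :=
      Literature.NumberTheory.GaloisRepresentations.charZero_adicCompletion v₀
    have h2 := (GenusKolyTwistingPrime.mem_torsionLocalKer_padic_iff W
      (RingEquivClass.toRingEquiv (Rat.HeightOneSpectrum.adicCompletion.padicEquiv (R := 𝓞 ℚ) v₀)) ((2 : ℕ) : ℤ) c).mpr h1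
    subst hv₀
    exact h2
  -- the strict group vanishes
  have hA : (kummerStrict W 2 S).selmerGroup = ⊥ := by
    rw [eq_bot_iff]
    intro c hc
    rw [AddSubgroup.mem_bot]
    have hcR : c ∈ (kummerRelaxed W 2 {(Sum.inl Rat.infinitePlace : Place ℚ)}).selmerGroup :=
      Summit.BirchSwinnertonDyer.Rank1Residual.GaloisImage.CoreRankZero.selmerGroup_mono (kummerStrict_le_kummerRelaxed_singleton_of_mem W 2 S hwS) hc
    refine hinj' c hcR ?_
    have h := (SelmerStructure.mem_selmerGroup_iff _ _).mp hc (Sum.inr v₀)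
    rwa [kummerStrict_of_mem W 2 S hv₀S, AddSubgroup.mem_bot] at h
  -- the mixed two-place count
  have hcount := relIndex_kummerStrict_kummerRelaxed_inl_inr_eq_of_facts W 2 hPT hEP Rat.isReal_infinitePlace v₀
  rw [← hSdef] at hcount
  rw [hA, AddSubgroup.relIndex_bot_left, hℓw, ht] at hcount
  exact hcount

/-! ## §3 `#Sel₂(W_K/K) = 8` and `#Ш(W_K/K)[2] = 4` at an identity-prime door -/

/-- ★ **THE K-SIDE OF THE IDENTITY-PRIME DOOR: `#Sel₂(W_K/K) = 8` and `#Ш(W_K/K)[2] = 4`.**  `W/ℚ` globally minimal elliptic on U₂'s identity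
locus (`Δ_W > 0`, rank `1`, `#Sel₂(W) = 2`, `¬ MeetsEgg`); `K` imaginary quadratic, `d_K = −ℓ` odd (`ℓ` prime), Heegner, `2` split; `ℓ` an identity
prime (`#W(ℚ_ℓ)[2] = 4`) with `loc_ℓ` injective on `Sel₂^{rel ∞}(W)`; `Ш(W_K/K)[2^∞]` finite (displayed).  PROOF (Kramer 1981 Thm. 1 at the identity
prime): on `M = Sel₂(W_K/K)` the endomorphism `m ↦ m + σ₀m` has kernel `M^{σ₀}`, whose classes descend (inflation–restriction, `W(K)[2] = 0`) into
`H¹_{𝓚^{∞,ℓ}}` (§1) of order `8` (§2), and image inside `κ₂(W(K))` (`PlusDescent.conjAct_sub_self_mem_range_kummerMapTorsion`; the reversed twin is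
`2`-Selmer-trivial by gk2-p2's door, so `Ш(W^{(d_K)}/ℚ)[2^∞] = 0`) of order `2` (`rank W(K) = 1`, `W(K)[2] = 0`): `#M ≤ 16`.  And `#M = 2 · #Ш(W_K)[2]`,
`#Ш(W_K)[2]` is a square (Cassels–Tate over `K`), `#M ≥ 4` (AN-10K): `#M = 8`.  UNCONDITIONAL; BSD is NOT proved by this.
[cite: Kramer1981, Thm. 1, Prop. 7, Thm. 2] [cite: MazurRubin2010, Lemma 3.2, Prop. 3.3] [cite: Cassels1962ArithmeticIV, §1] [cite: SilvermanAEC2009, Thm. X.4.2, Ex. 10.16] -/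
theorem natCard_selmerGroup_baseChange_eq_eight_and_sha_two_eq_four_of_identityDoor (hΔ : 0 < W.Δ)
    (hrk : W.mordellWeilRank = 1) (hSel : Nat.card (W.selmerGroup 2) = 2) (hegg : ¬ MeetsEgg W)
    (hK : IsImaginaryQuadratic K) (hodd : Odd (discr K)) (hH : SatisfiesHeegnerHypothesis (W.conductorNorm ℤ) K)
    (h2K : ((Ideal.span {(2 : ℤ)}).primesOver (𝓞 K)).ncard = 2)
    {ℓ : ℕ} [Fact ℓ.Prime] (hd : discr K = -(ℓ : ℤ))
    (hid : Nat.card {Q : (W.baseChange ℚ_[ℓ]).toAffine.Point // 2 • Q = 0} = 4)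
    (hinj : ∀ c ∈ selmerGroupRelaxedAtInfinityAtTwo W, c ∈ MazurRubin2010.strictLocalKer W ℚ_[ℓ] 2 → c = 0)
    [Finite (AddCommGroup.primaryComponent (W.baseChange K).sha 2)] :
    Nat.card ((W.baseChange K).selmerGroup ((2 : ℕ) : ℤ)) = 8 ∧
      Nat.card ((W.baseChange K).sha ⊓ AddSubgroup.torsionBy (W.baseChange K).galH1 ((2 : ℕ) : ℕ) : AddSubgroup _) = 4 := by
  haveI : Fact (Nat.Prime 2) := ⟨Nat.prime_two⟩
  haveI : (W.baseChange K).IsElliptic := inferInstanceAs ((W.map (algebraMap ℚ K)).IsElliptic)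
  have hℓ : ℓ.Prime := Fact.out
  have h2 : Module.finrank ℚ K = 2 := hK.1
  haveI : IsGalois ℚ K := isGalois_of_finrank_eq_two K h2
  -- descent data of `W/ℚ`
  have hT : NoRationalTwoTorsion W := EggAllImages.noRationalTwoTorsion_of_natCard_selmerGroup_eq_two W hSel (le_of_eq hrk.symm)
  have hSha : ShaTwoTrivial W := Egg.shaTwoTrivial_of_natCard_selmerGroup_eq_two W hSel (le_of_eq hrk.symm)
  have hstr := forall_mem_selmerGroup_localization_inl_eq_zero_of_not_meetsEgg W hΔ hT hSha hegg
  -- `√d_K ∈ K ∖ ℚ`, the non-trivial automorphism `σ₀`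
  obtain ⟨i, hθ, hc'⟩ := PlusDescent.exists_not_mem_range_sq_eq_discr (K := K) h2
  have hi : i ^ 2 = ((discr K : ℤ) : K) := by rw [hc', map_intCast]
  have hdneg : (discr K : ℤ) < 0 := by
    rw [hd]
    exact neg_neg_of_pos (by exact_mod_cast hℓ.pos)
  have hdQ0 : (discr K : ℚ) ≠ 0 := by exact_mod_cast NumberField.discr_ne_zero K
  set σ₀ : K ≃ₐ[ℚ] K := sigmaQ K h2 hθ hc' with hσ₀
  have hσ₀1 : σ₀ ≠ 1 := sigmaQ_ne_one K h2 hθ hc'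
  have h2t' : ∀ P : (W.baseChange K).toAffine.Point, ((2 : ℕ) : ℤ) • P = 0 → P = 0 := fun P hP ↦
    Summit.BirchSwinnertonDyer.Rank1Residual.F1Sign2.EggDoubling.eq_zero_of_two_smul_eq_zero_baseChange W hT h2 P
      (by rwa [natCast_zsmul] at hP)
  have hresinj := GenusExact.EigenClassesFinite.resTorsion_injective_of_noTorsion W K h2 hθ hc' ((2 : ℕ) : ℤ) h2t'
  -- the place `v₀` over `ℓ`
  obtain ⟨v₀, hv₀⟩ : ∃ v : HeightOneSpectrum (𝓞 ℚ), ((primesEquiv v : Nat.Primes) : ℕ) = ℓ :=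
    ⟨primesEquiv.symm ⟨ℓ, hℓ⟩, by rw [Equiv.apply_symm_apply]⟩
  have hℓv₀ : (ℓ : 𝓞 ℚ) ∈ v₀.asIdeal := by
    rw [← hv₀]
    exact Rat.HeightOneSpectrum.natCast_natGenerator_mem v₀
  set U := (kummerRelaxed W 2 {(Sum.inl Rat.infinitePlace : Place ℚ), Sum.inr v₀}).selmerGroup with hUdef
  have hU8 : Nat.card U = 8 := natCard_selmerGroup_kummerRelaxed_pair_eq_eight_of_identityDoor W K hΔ hK hodd hH hd hid hinj hv₀
  haveI : Finite U := Nat.finite_of_card_ne_zero (by rw [hU8]; norm_num)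
  -- the reversed twin is `2`-Selmer-trivial (gk2-p2's door), hence of rank `0` with `Ш[2^∞] = 0`
  haveI hTell : (W.quadraticTwist (discr K : ℚ)).IsElliptic := W.isElliptic_quadraticTwist hdQ0
  have hSel1 : Nat.card ((W.quadraticTwist (discr K : ℚ)).selmerGroup 2) = 1 :=
    natCard_selmerGroup_twin_eq_one_of_identityDoor W hΔ hSel hK hodd hH h2K hd hid hstr hinj (W.quadraticTwist (discr K : ℚ))
      ⟨1, one_smul _ _⟩
  have hSel1' : Nat.card ((W.quadraticTwist (discr K : ℚ)).selmerGroup ((2 : ℕ) : ℤ)) = 1 := by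
    rw [Nat.cast_ofNat]; exact hSel1
  have hT0 : ∀ x ∈ AddCommGroup.primaryComponent (↥(W.quadraticTwist (discr K : ℚ)).sha) 2, x = 0 := by
    intro x hx
    rwa [primaryComponent_sha_eq_bot_of_natCard_selmerGroup_eq_one (W.quadraticTwist (discr K : ℚ)) 2 hSel1', AddSubgroup.mem_bot] at hx
  have hrank0 : (W.quadraticTwist ((discr K : ℤ) : ℚ)).mordellWeilRank = 0 :=
    mordellWeilRank_quadraticTwist_eq_zero_of_twistSelmerTwoCard_eq_one W (d := discr K) (by exact_mod_cast hdneg.ne) hSel1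
  -- `rank W(K) = 1`, `W(K)[2] = 0`, `#Sel₂(W_K) = 2 · #Ш(W_K)[2]`
  have hrkK : (W.baseChange K).mordellWeilRank = 1 := mordellWeilRank_baseChange_eq_one W K hrk hdneg hrank0 h2 hi
  have htorsK := natCard_torsionBy_two_baseChange_eq_one W K hT h2
  have hmul := natCard_selmerGroup_baseChange_two_eq_two_mul W K hT h2 hrkK
  set M : AddSubgroup (galH1Torsion (W.baseChange K) ((2 : ℕ) : ℤ)) := (W.baseChange K).selmerGroup ((2 : ℕ) : ℤ) with hM
  haveI : Finite M := finite_selmerGroup_holds (W.baseChange K) (by norm_num)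
  -- the map `m ↦ m + σ₀ m`
  let g : M →+ galH1Torsion (W.baseChange K) ((2 : ℕ) : ℤ) :=
    (AddMonoidHom.id _ + conjAct W σ₀ ((2 : ℕ) : ℤ)).comp M.subtype
  have hg : ∀ m : M, g m = (m : galH1Torsion (W.baseChange K) ((2 : ℕ) : ℤ)) + conjAct W σ₀ _ m := fun m ↦ rfl
  have h2m : ∀ m : galH1Torsion (W.baseChange K) ((2 : ℕ) : ℤ), m + m = 0 := fun m ↦ by
    rw [← two_nsmul, ← natCast_zsmul]
    exact zsmul_discreteH1_torsion ((2 : ℕ) : ℤ) m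
  have hker_iff : ∀ m : M, m ∈ g.ker ↔ conjAct W σ₀ _ (m : galH1Torsion (W.baseChange K) ((2 : ℕ) : ℤ)) = m := by
    intro m
    rw [AddMonoidHom.mem_ker, hg]
    constructor
    · intro h
      have h1 := eq_neg_of_add_eq_zero_right h
      rw [h1, neg_eq_iff_add_eq_zero, h2m]
    · intro h
      rw [h, h2m]
  -- `#M = #ker · #range`
  have hcard : Nat.card M = Nat.card g.ker * Nat.card g.range := by
    rw [← AddSubgroup.index_ker, AddSubgroup.card_mul_index]
  -- `#ker ≤ #U = 8`: every `σ₀`-invariant class descends into `H¹_{𝓚^{∞,ℓ}}`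
  have hlift : ∀ m : g.ker, ∃ x : W.galH1Torsion ((2 : ℕ) : ℤ), x ∈ U ∧
      resTorsion W K ((2 : ℕ) : ℤ) x = ((m : M) : galH1Torsion (W.baseChange K) ((2 : ℕ) : ℤ)) := by
    intro m
    have hall : ∀ σ : K ≃ₐ[ℚ] K, conjAct W σ ((2 : ℕ) : ℤ) ((m : M) : galH1Torsion (W.baseChange K) ((2 : ℕ) : ℤ)) = (m : M) :=
      (RelModel.forall_conjAct_eq_iff_of_finrank_eq_two K W ((2 : ℕ) : ℤ) σ₀ h2 hσ₀1 _).mpr ((hker_iff m).mp m.2)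
    obtain ⟨x, hx⟩ := (GenusExact.EigenClassesFinite.mem_range_resTorsion_iff_conjAct_eq W K h2 hθ hc' _ h2t' _).mpr (hall _)
    refine ⟨x, ?_, hx⟩
    refine mem_selmerGroup_kummerRelaxed_pair_of_resTorsion_mem_selmerGroup W K h2 hodd hH hℓ hd hℓv₀ ?_
    rw [hx]
    exact (m : M).2
  have hker : Nat.card g.ker ≤ 8 := by
    rw [← hU8]
    refine Nat.card_le_card_of_injective
      (fun m ↦ (⟨Classical.choose (hlift m), (Classical.choose_spec (hlift m)).1⟩ : U)) fun m₁ m₂ h ↦ ?_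
    have h' : Classical.choose (hlift m₁) = Classical.choose (hlift m₂) := congrArg Subtype.val h
    apply Subtype.ext
    apply Subtype.ext
    rw [← (Classical.choose_spec (hlift m₁)).2, ← (Classical.choose_spec (hlift m₂)).2, h']
  -- `#range ≤ #κ₂(W(K)) = 2`
  have hT0' : ∀ x ∈ AddCommGroup.primaryComponent (↥(W.quadraticTwist (NumberField.discr K : ℚ)).sha) 2, x = 0 := hT0
  have hrange_le : g.range ≤ (kummerMapTorsion (W.baseChange K) ((2 : ℕ) : ℤ) (hdiv_two_baseChange W K)).range := by
    rintro z ⟨m, rfl⟩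
    rw [hg]
    have hsub := PlusDescent.conjAct_sub_self_mem_range_kummerMapTorsion W K hK hσ₀1 hT0' ⟨1, by norm_num⟩
      (hdiv_two_baseChange W K) (m : M).2
    have heq : ((m : M) : galH1Torsion (W.baseChange K) ((2 : ℕ) : ℤ)) + conjAct W σ₀ _ (m : M) =
        conjAct W σ₀ _ ((m : M) : galH1Torsion (W.baseChange K) ((2 : ℕ) : ℤ)) -
          ((m : M) : galH1Torsion (W.baseChange K) ((2 : ℕ) : ℤ)) := by
      rw [sub_eq_add_neg, add_comm, (neg_eq_iff_add_eq_zero.mpr (h2m _))]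
    rw [heq]
    exact hsub
  have hκ2 : Nat.card (kummerMapTorsion (W.baseChange K) ((2 : ℕ) : ℤ) (hdiv_two_baseChange W K)).range = 2 :=
    natCard_range_kummerMapTorsion_two_eq_two (W.baseChange K) (hdiv_two_baseChange W K) hrkK htorsK
  haveI : Finite (kummerMapTorsion (W.baseChange K) ((2 : ℕ) : ℤ) (hdiv_two_baseChange W K)).range :=
    Nat.finite_of_card_ne_zero (by rw [hκ2]; norm_num)
  have hrange : Nat.card g.range ≤ 2 := (AddSubgroup.card_le_of_le hrange_le).trans hκ2.le
  -- `#M ≤ 16`, `#M = 2 · #Ш[2]`, `#Ш[2]` a square, `#M ≥ 4`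
  have hM16 : Nat.card M ≤ 16 := by
    rw [hcard]
    calc Nat.card g.ker * Nat.card g.range ≤ 8 * 2 := Nat.mul_le_mul hker hrange
      _ = 16 := by norm_num
  have hM4 : 4 ≤ Nat.card M :=
    four_le_natCard_selmerGroup_baseChange_two_of_not_meetsEgg W K hΔ hT hrk hSha hegg hdneg hrank0 h2 hi
  have hsq : IsSquare (Nat.card ((W.baseChange K).sha ⊓ AddSubgroup.torsionBy (W.baseChange K).galH1 ((2 : ℕ) : ℕ) : AddSubgroup _)) := by
    rw [natCard_sha_inf_torsionBy_eq]
    have h := GenusExact.CasselsTateNumberField.isSquare_natCard_sha_torsionBy_pow (W.baseChange K) 2 1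
    rwa [pow_one] at h
  obtain ⟨r, hr⟩ := hsq
  -- `4 ≤ 2·r² ≤ 16` forces `r = 2`
  have hn2 : 2 ≤ r * r := by rw [← hr]; omega
  have hn8 : r * r ≤ 8 := by rw [← hr]; omega
  have hr2 : r = 2 := by
    have hr8 : r ≤ 8 := (Nat.le_mul_self r).trans hn8
    interval_cases r <;> omega
  subst hr2
  have h4 : Nat.card ((W.baseChange K).sha ⊓ AddSubgroup.torsionBy (W.baseChange K).galH1 ((2 : ℕ) : ℕ) : AddSubgroup _) = 4 := by
    rw [hr]
  refine ⟨?_, h4⟩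
  rw [hmul, h4]

/-! ## §4 `#Ш(W_K/K)[2^∞] = 4` at an identity-prime door -/

/-- ★ **`#Ш(W_K/K)[2^∞] = 4` AT AN IDENTITY-PRIME DOOR — the KEX_id docstring's «BSD predicts `#Ш(W_K)[2^∞] = 4`» is a theorem.**  Same frame as
`natCard_selmerGroup_baseChange_eq_eight_and_sha_two_eq_four_of_identityDoor`.  gk2-p4's one-bit law (`ShaCores.natCard_shaPrimary_le_torsionBy_mul_natCard`:
`#Ш(W_K)[2^∞] ≤ #Ш(W_K)[2] · #Ш(W)[2^∞]`, the reversed twin having `Ш[2^∞] = 0`) with `Ш(W)[2^∞] = 0` (`#Sel₂(W) = 2`, rank `1`) gives `≤ 4`, and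
`Ш(W_K)[2] ⊆ Ш(W_K)[2^∞]` gives `≥ 4`.  CONSEQUENCE FOR LINE 23: on the identity locus KEX_id's `Ш`-factor is the constant `4`, i.e. KEX_id ⟺
«`2^{ord₂ c + ord₂ C(W) + 1} ∥ P(1)`».  UNCONDITIONAL; BSD is NOT proved by this; nothing is closed.
[cite: Kramer1981, Thm. 1, Thm. 2] [cite: GrossLMS1991, §5 (5.1)–(5.3)] [cite: Cassels1962ArithmeticIV, §1] -/
theorem natCard_primaryComponent_sha_baseChange_two_eq_four_of_identityDoor (hΔ : 0 < W.Δ)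
    (hrk : W.mordellWeilRank = 1) (hSel : Nat.card (W.selmerGroup 2) = 2) (hegg : ¬ MeetsEgg W)
    (hK : IsImaginaryQuadratic K) (hodd : Odd (discr K)) (hH : SatisfiesHeegnerHypothesis (W.conductorNorm ℤ) K)
    (h2K : ((Ideal.span {(2 : ℤ)}).primesOver (𝓞 K)).ncard = 2)
    {ℓ : ℕ} [Fact ℓ.Prime] (hd : discr K = -(ℓ : ℤ))
    (hid : Nat.card {Q : (W.baseChange ℚ_[ℓ]).toAffine.Point // 2 • Q = 0} = 4)
    (hinj : ∀ c ∈ selmerGroupRelaxedAtInfinityAtTwo W, c ∈ MazurRubin2010.strictLocalKer W ℚ_[ℓ] 2 → c = 0)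
    [Finite (AddCommGroup.primaryComponent (W.baseChange K).sha 2)] :
    Nat.card (AddCommGroup.primaryComponent (W.baseChange K).sha 2) = 4 := by
  haveI : Fact (Nat.Prime 2) := ⟨Nat.prime_two⟩
  have hℓ : ℓ.Prime := Fact.out
  have h2 : Module.finrank ℚ K = 2 := hK.1
  obtain ⟨-, h4⟩ := natCard_selmerGroup_baseChange_eq_eight_and_sha_two_eq_four_of_identityDoor W K hΔ hrk hSel hegg hK hodd hH h2K hd
    hid hinj
  rw [natCard_sha_inf_torsionBy_eq] at h4
  -- `σ₀`, the trivial twin `Ш`, `Ш(W)[2^∞] = 0`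
  obtain ⟨i, hθ, hc'⟩ := PlusDescent.exists_not_mem_range_sq_eq_discr (K := K) h2
  have hσ₀1 : sigmaQ K h2 hθ hc' ≠ 1 := sigmaQ_ne_one K h2 hθ hc'
  have hdQ0 : (discr K : ℚ) ≠ 0 := by exact_mod_cast NumberField.discr_ne_zero K
  haveI hTell : (W.quadraticTwist (discr K : ℚ)).IsElliptic := W.isElliptic_quadraticTwist hdQ0
  have hT : NoRationalTwoTorsion W := EggAllImages.noRationalTwoTorsion_of_natCard_selmerGroup_eq_two W hSel (le_of_eq hrk.symm)
  have hSha : ShaTwoTrivial W := Egg.shaTwoTrivial_of_natCard_selmerGroup_eq_two W hSel (le_of_eq hrk.symm)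
  have hstr := forall_mem_selmerGroup_localization_inl_eq_zero_of_not_meetsEgg W hΔ hT hSha hegg
  have hSel1 : Nat.card ((W.quadraticTwist (discr K : ℚ)).selmerGroup 2) = 1 :=
    natCard_selmerGroup_twin_eq_one_of_identityDoor W hΔ hSel hK hodd hH h2K hd hid hstr hinj (W.quadraticTwist (discr K : ℚ))
      ⟨1, one_smul _ _⟩
  have hSel1' : Nat.card ((W.quadraticTwist (discr K : ℚ)).selmerGroup ((2 : ℕ) : ℤ)) = 1 := by
    rw [Nat.cast_ofNat]; exact hSel1
  have hT0 : ∀ x ∈ AddCommGroup.primaryComponent (↥(W.quadraticTwist (discr K : ℚ)).sha) 2, x = 0 := by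
    intro x hx
    rwa [primaryComponent_sha_eq_bot_of_natCard_selmerGroup_eq_one (W.quadraticTwist (discr K : ℚ)) 2 hSel1', AddSubgroup.mem_bot] at hx
  obtain ⟨-, -, hW0⟩ := rank_eq_one_and_sha_primary_eq_zero_of_natCard_selmerGroup_eq_two W hSel (le_of_eq hrk.symm)
  have hbotW : AddCommGroup.primaryComponent (↥W.sha) 2 = ⊥ := (AddSubgroup.eq_bot_iff_forall _).mpr hW0
  haveI : Finite (AddCommGroup.primaryComponent (↥W.sha) 2) := by rw [hbotW]; infer_instance
  have hW1 : Nat.card (AddCommGroup.primaryComponent (↥W.sha) 2) = 1 := by rw [hbotW, AddSubgroup.card_bot]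
  -- `≤ 4`
  have hle := ShaCores.natCard_shaPrimary_le_torsionBy_mul_natCard W K hK hσ₀1 hT0
  rw [h4, hW1, mul_one] at hle
  -- `≥ 4`: `Ш[2] ⊆ Ш[2^∞]`
  have hge : 4 ≤ Nat.card (AddCommGroup.primaryComponent (↥(W.baseChange K).sha) 2) := by
    rw [← h4]
    refine Nat.card_le_card_of_injective
      (fun x ↦ (⟨(x : ↥(W.baseChange K).sha), (AddCommGroup.mem_primaryComponent).mpr ⟨1, by
        rw [pow_one]; exact AddSubgroup.torsionBy.nsmul_iff.mp x.2⟩⟩ :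
          AddCommGroup.primaryComponent (↥(W.baseChange K).sha) 2)) fun x y h ↦ ?_
    apply Subtype.ext
    simpa using congrArg (fun z : AddCommGroup.primaryComponent (↥(W.baseChange K).sha) 2 ↦ (z : ↥(W.baseChange K).sha)) h
  omega

end Summit.BirchSwinnertonDyer.BirchSwinnertonDyer.Theorems.GenusExact.TwinSwap.IdentityDoorSha

end
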